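import Summits.QuantumFields.YangMills.Theorems.BalabanLadderUVSeamRecPolymerInfluence
import Summits.QuantumFields.YangMills.Theorems.LangevinControlUVOSLegsFromFemtoAndGapDefs
import HarnessLib

/-!
# Crux `UVSeamRec` (stmt-QuantumFields-20043): PERIOD CLASSES of tempered-d1's block-plaquettes on an odd torus — the lifted
# large-field event depends on the period class only, and the family shell FOLDS along period classes into a period-free polymer
# system with the same domination, the same clause-(ii) constant `Λ = 1` and the same density budget

Helper file (`--supports stmt-QuantumFields-20043`) of the width-lever seat `ym-20043-ceilings-p2` (lane B, gen 3); consumed by the sequel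
`…CeilingsResponseCarriersPeriodic.lean` (the (β) press-button p543486 with the product law asked only of PERIOD-FREE subfamilies).
THE CAVEAT OF RECORD (owner R119a (b); g2 note §5).  p543486 asks, per odd torus `2L+1` and separated cube family, for weights `w γ ≥ 0` on
tempered-d1's `familyShell` with a density budget and the product law `⟨∏_{γ∈A} 1_{largeFieldEvent γ}∘lift⟩_{2L+1,β} ≤ ∏_{γ∈A} w γ` for
EVERY `A ⊆ familyShell`.  Two block-plaquettes `γ ≠ γ'` of the family shell (in the shells of different cubes) that differ by a period —
same level `k`, same orientation, anchors `b^k y ≡ b^k y' (mod 2L+1)` coordinatewise, i.e. the same PERIOD CLASS `(k, b^k y mod 2L+1, μ, ν)` — carry the SAME event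
on periodic lifts (§1 `indicator_largeFieldEvent_torusLift_eq_of_periodClass_eq`: the two chart origins are congruent and the chart of a
`(2L+1)`-periodic configuration only sees origins `mod 2L+1`; nothing about the block averaging is used), so for `A = {γ, γ'}` that law
reads `μ(E) ≤ w γ · w γ'` — unsatisfiable with small (e.g. level-periodic) weights.  §2 is the CYCLIC pigeonhole replacing tempered-d1's
`ℤ⁴` one (`sum_familyCoeff_le_one`): a period class meets each shell at most once (`4R+4 < 2L+1`), and the cubes whose shells it meets are
pairwise cyclically `2R+4`-separated and cyclically within `2R+2` of the common anchor class, hence at most `16` (orthants of `valMinAbs`),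
so the FIBRE-SUMMED family coefficients still satisfy `Σ_i ≤ 16·(1/16) = 1`.  §3 folds: representatives = `w`-minimisers of the fibres
(the budget transfers with the same `W`), coefficients = fibre sums (domination (i) stays an identity), product law needed on the
representatives only — a period-free family.  HONEST FRAMING: bookkeeping for the OPEN block-level product law of the (β) architecture of
(RM); nothing of E0′; not a gap, not Clay.

References: folklore (torus periodicity, pigeonhole); T. Bałaban, Commun. Math. Phys. 122 (1989) 355–392 for the intended supplier.
-/

set_option autoImplicit false

noncomputable section

open MeasureTheory Filter Topology Finset
open Literature.Probability.LatticeModels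
open Literature.MathematicalPhysics.QuantumFieldTheory (GaugeConfig LatticeRep)
open Literature.MathematicalPhysics.QuantumLattice

namespace Summit.QuantumFields.YangMills.Cruxes.UVSeamRec.TemperedResponse

open Summit.QuantumFields.YangMills.Cruxes.OSLegsFromFemtoAndGap.DlrCollarTransfer
open Summit.QuantumFields.YangMills.Cruxes.UVSeamRec.PolymerData

/-! ## §1 Period classes of block-plaquettes and the periodicity of the lifted large-field events -/

section PeriodClass

/-- The chart of a `(2L+1)`-periodic configuration only sees the chart origin `mod 2L+1`. [folklore] -/
theorem chart_torusLift_eq_of_congr {G : Type*} {M : ℕ} (L : ℕ) (o o' : Fin 4 → ℤ)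
    (h : ∀ i, ((o i : ℤ) : ZMod (2 * L + 1)) = ((o' i : ℤ) : ZMod (2 * L + 1)))
    (U : GaugeConfig 4 (2 * L + 1) G) :
    chart (M := M) o (torusLift (2 * L + 1) U) = chart (M := M) o' (torusLift (2 * L + 1) U) := by
  funext e
  simp only [chart_apply, torusLift, Function.comp_apply, torusEdge]
  congr 2
  funext i
  simp only [Torus.proj_apply, Int.cast_add, h i]

variable {N : ℕ} [NeZero N]

/-- Block indices `y, y'` with `b^k y ≡ b^k y' (mod 2L+1)` give the same `k`-level block-averaged plaquette field on periodic lifts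
(the two chart origins `b^k(y − (b−1)𝟙)`, `b^k(y' − (b−1)𝟙)` are congruent). [folklore] -/
theorem blockField_torusLift_eq_of_congr (𝔟 : BlockSize) (k : ℕ) (y y' : Fin 4 → ℤ) (μ ν : Fin 4) (hμν : μ < ν) (L : ℕ)
    (h : ∀ i, (((𝔟.b : ℤ) ^ k * y i : ℤ) : ZMod (2 * L + 1)) = (((𝔟.b : ℤ) ^ k * y' i : ℤ) : ZMod (2 * L + 1)))
    (U : GaugeConfig 4 (2 * L + 1) (Matrix.specialUnitaryGroup (Fin N) ℂ)) :
    blockField (N := N) 𝔟 k y μ ν hμν (torusLift (2 * L + 1) U) =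
      blockField (N := N) 𝔟 k y' μ ν hμν (torusLift (2 * L + 1) U) := by
  unfold blockField
  rw [chart_torusLift_eq_of_congr L (chartOrigin 𝔟 k y) (chartOrigin 𝔟 k y') _ U]
  intro i
  simp only [chartOrigin, mul_sub, Int.cast_sub, h i]

/-- **POLYMERS OF ONE PERIOD CLASS CARRY ONE LIFTED EVENT.**  If `γ, γ'` have the same period class `(k, b^k y mod 2L+1, μ, ν)` then on
every periodic lift `torusLift (2L+1) U` the large-field indicators of `γ` and `γ'` (thresholds depending on the level only) coincide. [folklore] -/
theorem indicator_largeFieldEvent_torusLift_eq_of_periodClass_eq (𝔟 : BlockSize) (ε : ℕ → ℝ) (L : ℕ) {γ γ' : Polymer}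
    (h : (γ.k, Torus.proj (2 * L + 1) (anchor 𝔟 γ), γ.μ, γ.ν) =
      (γ'.k, Torus.proj (2 * L + 1) (anchor 𝔟 γ'), γ'.μ, γ'.ν))
    (U : GaugeConfig 4 (2 * L + 1) (Matrix.specialUnitaryGroup (Fin N) ℂ)) :
    (largeFieldEvent (N := N) 𝔟 (ε γ.k) γ).indicator (fun _ => (1 : ℝ)) (torusLift (2 * L + 1) U) =
      (largeFieldEvent (N := N) 𝔟 (ε γ'.k) γ').indicator (fun _ => (1 : ℝ)) (torusLift (2 * L + 1) U) := by
  obtain ⟨k, y, μ, ν, hμν⟩ := γ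
  obtain ⟨k', y', μ', ν', hμν'⟩ := γ'
  simp only [Prod.mk.injEq] at h
  obtain ⟨rfl, hy, rfl, rfl⟩ := h
  have hmem : torusLift (2 * L + 1) U ∈ largeFieldEvent (N := N) 𝔟 (ε k) ⟨k, y, μ, ν, hμν⟩ ↔
      torusLift (2 * L + 1) U ∈ largeFieldEvent (N := N) 𝔟 (ε k) ⟨k, y', μ, ν, hμν'⟩ := by
    show ε k ≤ blockField (N := N) 𝔟 k y μ ν hμν (torusLift (2 * L + 1) U) ↔
      ε k ≤ blockField (N := N) 𝔟 k y' μ ν hμν' (torusLift (2 * L + 1) U)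
    rw [blockField_torusLift_eq_of_congr 𝔟 k y y' μ ν hμν L (fun i => congr_fun hy i) U]
  classical
  by_cases hU : torusLift (2 * L + 1) U ∈ largeFieldEvent (N := N) 𝔟 (ε k) ⟨k, y, μ, ν, hμν⟩
  · rw [Set.indicator_of_mem hU, Set.indicator_of_mem (hmem.1 hU)]
  · rw [Set.indicator_of_notMem hU, Set.indicator_of_notMem (fun h' => hU (hmem.2 h'))]

/-- Two polymers of one period class in the shell of ONE cube coincide: their anchors are congruent `mod 2L+1` and within
sup-distance `4R+4 < 2L+1` of each other. [folklore] -/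
theorem eq_of_mem_shell_of_periodClass_eq (𝔟 : BlockSize) {kmax R L : ℕ} (hRL : 4 * R + 8 ≤ L) {z : Fin 4 → ℤ}
    {γ γ' : Polymer} (hγ : γ ∈ shell 𝔟 kmax R z) (hγ' : γ' ∈ shell 𝔟 kmax R z)
    (h : (γ.k, Torus.proj (2 * L + 1) (anchor 𝔟 γ), γ.μ, γ.ν) =
      (γ'.k, Torus.proj (2 * L + 1) (anchor 𝔟 γ'), γ'.μ, γ'.ν)) : γ = γ' := by
  have hd := supDist_le_of_mem_shell hγ
  have hd' := supDist_le_of_mem_shell hγ'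
  obtain ⟨k, y, μ, ν, hμν⟩ := γ
  obtain ⟨k', y', μ', ν', hμν'⟩ := γ'
  simp only [Prod.mk.injEq] at h
  obtain ⟨rfl, hy, rfl, rfl⟩ := h
  have hyy : y = y' := by
    funext i
    have hc : (((anchor 𝔟 ⟨k, y, μ, ν, hμν⟩ i : ℤ)) : ZMod (2 * L + 1)) =
        ((anchor 𝔟 ⟨k, y', μ, ν, hμν'⟩ i : ℤ) : ZMod (2 * L + 1)) := congr_fun hy i
    rw [ZMod.intCast_eq_intCast_iff_dvd_sub] at hc
    have h1 : ((z i - anchor 𝔟 ⟨k, y, μ, ν, hμν⟩ i).natAbs : ℤ) ≤ ((2 * R + 2 : ℕ) : ℤ) := by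
      exact_mod_cast (PolymerData.natAbs_sub_le_supDist z _ i).trans hd
    have h2 : ((z i - anchor 𝔟 ⟨k, y', μ, ν, hμν'⟩ i).natAbs : ℤ) ≤ ((2 * R + 2 : ℕ) : ℤ) := by
      exact_mod_cast (PolymerData.natAbs_sub_le_supDist z _ i).trans hd'
    rw [Int.natCast_natAbs] at h1 h2
    push_cast at h1 h2
    have habs : |anchor 𝔟 ⟨k, y', μ, ν, hμν'⟩ i - anchor 𝔟 ⟨k, y, μ, ν, hμν⟩ i| < ((2 * L + 1 : ℕ) : ℤ) := by
      have := abs_sub_le (anchor 𝔟 ⟨k, y', μ, ν, hμν'⟩ i) (z i) (anchor 𝔟 ⟨k, y, μ, ν, hμν⟩ i)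
      rw [abs_sub_comm (anchor 𝔟 ⟨k, y', μ, ν, hμν'⟩ i) (z i)] at this
      push_cast
      linarith
    have h0 := Int.eq_zero_of_abs_lt_dvd hc habs
    have hbk : ((𝔟.b : ℤ) ^ k) ≠ 0 := pow_ne_zero _ (by exact_mod_cast 𝔟.pos.ne')
    have : (𝔟.b : ℤ) ^ k * y' i = (𝔟.b : ℤ) ^ k * y i := by
      simp only [anchor] at h0
      linarith
    exact (mul_left_cancel₀ hbk this).symm
  subst hyy
  rfl

end PeriodClass

/-! ## §2 The cyclic pigeonhole: a period class meets at most `16` separated shells, with total coefficient `≤ 1` -/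

section Pigeonhole

variable {N : ℕ} [NeZero N]

/-- `valMinAbs` of the cast of a small integer is that integer (`|m| ≤ L` on the torus of side `2L+1`). [folklore] -/
theorem valMinAbs_intCast_of_abs_le (L : ℕ) {m : ℤ} (hm : |m| ≤ L) :
    (((m : ZMod (2 * L + 1))).valMinAbs : ℤ) = m := by
  rw [ZMod.valMinAbs_spec]
  refine ⟨rfl, ?_, ?_⟩
  · have := (abs_le.1 hm).1
    push_cast
    linarith
  · have := (abs_le.1 hm).2
    push_cast
    linarith

/-- **THE CYCLIC PIGEONHOLE.**  For a cube family pairwise cyclically `2R+4`-separated in some coordinate (`4R+8 ≤ L`) and a period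
class: the cubes whose shell contains a polymer of that class number at most `16` — all such centres are cyclically within `2R+2` of
the common anchor class in every coordinate, and two centres in one orthant of `valMinAbs(x − anchor)` would be cyclically within
`2R+2` of each other in every coordinate. [folklore] -/
theorem card_filter_shell_meets_class_le (𝔟 : BlockSize) (kmax R : ℕ) {n L : ℕ} (hRL : 4 * R + 8 ≤ L)
    (x : Fin n → (Fin 4 → ℤ))
    (hsep : ∀ i j : Fin n, i ≠ j → ∃ k : Fin 4,
      (2 * (R : ℤ) + 4) ≤ |((((x i k - x j k : ℤ) : ZMod (2 * L + 1))).valMinAbs : ℤ)|)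
    (v : ℕ × (Fin 4 → ZMod (2 * L + 1)) × Fin 4 × Fin 4) :
    (Finset.univ.filter fun i => ∃ γ ∈ shell 𝔟 kmax R (x i),
      (γ.k, Torus.proj (2 * L + 1) (anchor 𝔟 γ), γ.μ, γ.ν) = v).card ≤ 16 := by
  classical
  set T : Finset (Fin n) := Finset.univ.filter fun i => ∃ γ ∈ shell 𝔟 kmax R (x i),
    (γ.k, Torus.proj (2 * L + 1) (anchor 𝔟 γ), γ.μ, γ.ν) = v with hT
  -- the cyclic offsets of the centres from the common anchor class
  set z : Fin n → Fin 4 → ℤ := fun i c => ((((x i c : ℤ) : ZMod (2 * L + 1)) - v.2.1 c).valMinAbs : ℤ) with hz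
  have hnear : ∀ i ∈ T, ∀ c : Fin 4, |z i c| ≤ 2 * (R : ℤ) + 2 := by
    intro i hi c
    obtain ⟨γ, hγ, hγv⟩ := (Finset.mem_filter.1 hi).2
    have hvc : v.2.1 c = ((anchor 𝔟 γ c : ℤ) : ZMod (2 * L + 1)) := by
      rw [← hγv]; simp only [Torus.proj_apply]
    have h1 : ((x i c - anchor 𝔟 γ c).natAbs : ℤ) ≤ ((2 * R + 2 : ℕ) : ℤ) := by
      exact_mod_cast (PolymerData.natAbs_sub_le_supDist (x i) (anchor 𝔟 γ) c).trans (supDist_le_of_mem_shell hγ)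
    rw [Int.natCast_natAbs] at h1
    push_cast at h1
    have h2 : z i c = (((x i c - anchor 𝔟 γ c : ℤ) : ZMod (2 * L + 1))).valMinAbs := by
      simp only [hz, hvc, Int.cast_sub]
    rw [h2]
    exact (abs_valMinAbs_intCast_le L _).trans h1
  -- the cyclic difference of two centres is the difference of their offsets
  have hval : ∀ i ∈ T, ∀ j ∈ T, ∀ c : Fin 4, |z i c - z j c| ≤ (L : ℤ) →
      ((((x i c - x j c : ℤ) : ZMod (2 * L + 1))).valMinAbs : ℤ) = z i c - z j c := by
    intro i _ j _ c hc
    have hcast : ((x i c - x j c : ℤ) : ZMod (2 * L + 1)) = ((z i c - z j c : ℤ) : ZMod (2 * L + 1)) := by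
      simp only [hz, Int.cast_sub, ZMod.coe_valMinAbs]
      ring
    rw [hcast]
    exact valMinAbs_intCast_of_abs_le L hc
  -- orthants
  have hinj : Set.InjOn (fun i : Fin n => fun c : Fin 4 => decide (0 ≤ z i c)) ↑T := by
    intro i hi j hj hfij
    by_contra hij
    obtain ⟨c, hc⟩ := hsep i j hij
    have hic := abs_le.1 (hnear i hi c)
    have hjc := abs_le.1 (hnear j hj c)
    have hf : decide (0 ≤ z i c) = decide (0 ≤ z j c) := congr_fun hfij c
    have hiff : (0 ≤ z i c ↔ 0 ≤ z j c) := by simpa using hf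
    have hsmall : |z i c - z j c| ≤ 2 * (R : ℤ) + 2 := by
      rcases le_or_gt 0 (z i c) with h | h
      · have h' := hiff.1 h
        exact abs_le.2 ⟨by linarith, by linarith⟩
      · have h' : z j c < 0 := lt_of_not_ge fun h'' => (not_le.2 h) (hiff.2 h'')
        exact abs_le.2 ⟨by linarith, by linarith⟩
    have hL : |z i c - z j c| ≤ (L : ℤ) := hsmall.trans (by omega)
    rw [hval i hi j hj c hL] at hc
    linarith
  have h := Finset.card_le_card_of_injOn (fun i : Fin n => fun c : Fin 4 => decide (0 ≤ z i c))
    (fun i _ => Finset.mem_coe.2 (Finset.mem_univ _)) hinj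
  simpa using h

/-- A period class meets the shell of one cube in at most one polymer (`eq_of_mem_shell_of_periodClass_eq`), so the fibre sum of
the family coefficients of cube `i` is at most `1/16` if the class meets the shell of cube `i` and `0` otherwise. [folklore] -/
theorem sum_fiber_familyCoeff_le (𝔟 : BlockSize) (kmax R : ℕ) {n L : ℕ} (hRL : 4 * R + 8 ≤ L) (x : Fin n → (Fin 4 → ℤ))
    (S : Finset Polymer) (v : ℕ × (Fin 4 → ZMod (2 * L + 1)) × Fin 4 × Fin 4) (i : Fin n) :
    ∑ γ ∈ S.filter (fun γ => (γ.k, Torus.proj (2 * L + 1) (anchor 𝔟 γ), γ.μ, γ.ν) = v), familyCoeff 𝔟 kmax R x i γ ≤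
      if ∃ γ ∈ shell 𝔟 kmax R (x i), (γ.k, Torus.proj (2 * L + 1) (anchor 𝔟 γ), γ.μ, γ.ν) = v then (1 / 16 : ℝ) else 0 := by
  classical
  -- only the members in the shell of cube `i` contribute
  have hsum : ∑ γ ∈ S.filter (fun γ => (γ.k, Torus.proj (2 * L + 1) (anchor 𝔟 γ), γ.μ, γ.ν) = v), familyCoeff 𝔟 kmax R x i γ =
      ∑ γ ∈ (S.filter (fun γ => (γ.k, Torus.proj (2 * L + 1) (anchor 𝔟 γ), γ.μ, γ.ν) = v)).filter (fun γ => γ ∈ shell 𝔟 kmax R (x i)),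
        influenceCoeff 𝔟 γ (x i) := by
    rw [Finset.sum_filter (p := fun γ => γ ∈ shell 𝔟 kmax R (x i))]
    rfl
  rw [hsum]
  set F := (S.filter (fun γ => (γ.k, Torus.proj (2 * L + 1) (anchor 𝔟 γ), γ.μ, γ.ν) = v)).filter (fun γ => γ ∈ shell 𝔟 kmax R (x i)) with hF
  have hcard : F.card ≤ 1 := by
    refine Finset.card_le_one.2 fun γ hγ γ' hγ' => ?_
    have h1 := Finset.mem_filter.1 hγ
    have h2 := Finset.mem_filter.1 hγ'
    exact eq_of_mem_shell_of_periodClass_eq 𝔟 hRL h1.2 h2.2 ((Finset.mem_filter.1 h1.1).2.trans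
      (Finset.mem_filter.1 h2.1).2.symm)
  have hle : ∑ γ ∈ F, influenceCoeff 𝔟 γ (x i) ≤ F.card • (1 / 16 : ℝ) :=
    Finset.sum_le_card_nsmul _ _ _ fun γ hγ => influenceCoeff_le_of_mem_shell (Finset.mem_filter.1 hγ).2
  split_ifs with hex
  · refine hle.trans ?_
    rw [nsmul_eq_mul]
    have : (F.card : ℝ) ≤ 1 := by exact_mod_cast hcard
    linarith
  · have hempty : F = ∅ := by
      refine Finset.eq_empty_of_forall_notMem fun γ hγ => hex ?_
      have h1 := Finset.mem_filter.1 hγ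
      exact ⟨γ, h1.2, (Finset.mem_filter.1 h1.1).2⟩
    rw [hempty, Finset.sum_empty]

/-- **CLAUSE (ii) FOR THE FOLDED SYSTEM: `Σ_i (fibre-summed coefficients) ≤ 1`.**  For a cube family pairwise cyclically
`2R+4`-separated (`4R+8 ≤ L`) and any period class `v`: `Σ_i Σ_{γ ∈ S, class γ = v} familyCoeff i γ ≤ 16 · (1/16) = 1`. [folklore] -/
theorem sum_sum_fiber_familyCoeff_le_one (𝔟 : BlockSize) (kmax R : ℕ) {n L : ℕ} (hRL : 4 * R + 8 ≤ L)
    (x : Fin n → (Fin 4 → ℤ))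
    (hsep : ∀ i j : Fin n, i ≠ j → ∃ k : Fin 4,
      (2 * (R : ℤ) + 4) ≤ |((((x i k - x j k : ℤ) : ZMod (2 * L + 1))).valMinAbs : ℤ)|)
    (S : Finset Polymer) (v : ℕ × (Fin 4 → ZMod (2 * L + 1)) × Fin 4 × Fin 4) :
    ∑ i, ∑ γ ∈ S.filter (fun γ => (γ.k, Torus.proj (2 * L + 1) (anchor 𝔟 γ), γ.μ, γ.ν) = v), familyCoeff 𝔟 kmax R x i γ ≤ (1 : ℝ) := by
  classical
  have h1 : ∑ i, ∑ γ ∈ S.filter (fun γ => (γ.k, Torus.proj (2 * L + 1) (anchor 𝔟 γ), γ.μ, γ.ν) = v), familyCoeff 𝔟 kmax R x i γ ≤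
      ∑ i : Fin n, if ∃ γ ∈ shell 𝔟 kmax R (x i), (γ.k, Torus.proj (2 * L + 1) (anchor 𝔟 γ), γ.μ, γ.ν) = v then (1 / 16 : ℝ) else 0 :=
    Finset.sum_le_sum fun i _ => sum_fiber_familyCoeff_le 𝔟 kmax R hRL x S v i
  refine h1.trans ?_
  rw [← Finset.sum_filter, Finset.sum_const, nsmul_eq_mul]
  have hc := card_filter_shell_meets_class_le 𝔟 kmax R hRL x hsep v
  have : ((Finset.univ.filter fun i => ∃ γ ∈ shell 𝔟 kmax R (x i), (γ.k, Torus.proj (2 * L + 1) (anchor 𝔟 γ), γ.μ, γ.ν) = v).card : ℝ) ≤ 16 := by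
    exact_mod_cast hc
  linarith

end Pigeonhole

/-! ## §3 The fold: a period-free polymer system dominating the influence functionals, from a period-free product law -/

section Fold

variable {N : ℕ} [NeZero N]

/-- **THE FOLD ALONG PERIOD CLASSES.**  Structure group `SU(N)`, any lattice representation `r`, block size `𝔟`, per-level thresholds
`ε`, level cutoff `kmax`, odd torus `2L+1`, cube family `x` pairwise cyclically `2R+4`-separated with `4R+8 ≤ L`.  From weights
`w γ ≥ 0` on `familyShell 𝔟 kmax R x` with density budget `Σ_γ familyCoeff i γ · w γ ≤ W` (all `i`) and the product law
`⟨∏_{γ∈A} 1_{largeFieldEvent 𝔟 (ε γ.k) γ}∘lift⟩ ≤ ∏_{γ∈A} w γ` for the PERIOD-FREE `A ⊆ familyShell` only, a polymer system in the exact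
shape of p535725/p541829's (PL) hypothesis: events measurable, weights and coefficients nonnegative, DOMINATION (i) of every
`influence 𝔟 ε kmax R (x i)∘lift`, clause (ii) with `Λ = 1`, budget `W`, and the product law on ALL subfamilies.  Construction: index set
= one `w`-minimising representative per period class of the family shell; coefficients = fibre sums of `familyCoeff`. [folklore] -/
theorem exists_polymerSystem_of_periodFree (r : LatticeRep (Matrix.specialUnitaryGroup (Fin N) ℂ)) (𝔟 : BlockSize)
    (ε : ℕ → ℝ) (kmax R L : ℕ) (β : ℝ) {n : ℕ} (x : Fin n → (Fin 4 → ℤ)) (hRL : 4 * R + 8 ≤ L)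
    (hsep : ∀ i j : Fin n, i ≠ j → ∃ k : Fin 4,
      (2 * (R : ℤ) + 4) ≤ |((((x i k - x j k : ℤ) : ZMod (2 * L + 1))).valMinAbs : ℤ)|)
    {W : ℝ} (w : Polymer → ℝ) (hw0 : ∀ γ ∈ familyShell 𝔟 kmax R x, 0 ≤ w γ)
    (hwW : ∀ i, ∑ γ ∈ familyShell 𝔟 kmax R x, familyCoeff 𝔟 kmax R x i γ * w γ ≤ W)
    (hpl : ∀ A, A ⊆ familyShell 𝔟 kmax R x → Set.InjOn (fun γ : Polymer => (γ.k, Torus.proj (2 * L + 1) (anchor 𝔟 γ), γ.μ, γ.ν)) ↑A →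
      torusE (Matrix.specialUnitaryGroup (Fin N) ℂ) r β L (fun U => ∏ γ ∈ A,
        (largeFieldEvent (N := N) 𝔟 (ε γ.k) γ).indicator (fun _ => (1 : ℝ)) U) ≤ ∏ γ ∈ A, w γ) :
    ∃ (κ : Type) (S : Finset κ) (E : κ → Set (LGConfig 4 (Matrix.specialUnitaryGroup (Fin N) ℂ))) (w' : κ → ℝ)
      (c : Fin n → κ → ℝ),
      (∀ γ, MeasurableSet (E γ)) ∧ (∀ γ ∈ S, 0 ≤ w' γ) ∧ (∀ i, ∀ γ ∈ S, 0 ≤ c i γ) ∧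
      (∀ (i : Fin n) (U : GaugeConfig 4 (2 * L + 1) (Matrix.specialUnitaryGroup (Fin N) ℂ)),
        influence (N := N) 𝔟 ε kmax R (x i) (torusLift (2 * L + 1) U) ≤
          ∑ γ ∈ S, c i γ * (E γ).indicator (fun _ => (1 : ℝ)) (torusLift (2 * L + 1) U)) ∧
      (∀ γ ∈ S, ∑ i, c i γ ≤ (1 : ℝ)) ∧ (∀ i, ∑ γ ∈ S, c i γ * w' γ ≤ W) ∧
      (∀ A, A ⊆ S → torusE (Matrix.specialUnitaryGroup (Fin N) ℂ) r β L (fun U => ∏ γ ∈ A,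
        (E γ).indicator (fun _ => (1 : ℝ)) U) ≤ ∏ γ ∈ A, w' γ) := by
  classical
  set fS : Finset Polymer := familyShell 𝔟 kmax R x with hfS
  set pc : Polymer → ℕ × (Fin 4 → ZMod (2 * L + 1)) × Fin 4 × Fin 4 :=
    (fun γ : Polymer => (γ.k, Torus.proj (2 * L + 1) (anchor 𝔟 γ), γ.μ, γ.ν)) with hpc
  -- the period classes present in the family shell and their fibres
  set V := fS.image pc with hV
  have hfib : ∀ v ∈ V, (fS.filter fun γ => pc γ = v).Nonempty := by
    intro v hv
    obtain ⟨γ, hγ, rfl⟩ := Finset.mem_image.1 hv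
    exact ⟨γ, Finset.mem_filter.2 ⟨hγ, rfl⟩⟩
  -- one `w`-minimising representative per class
  set ρ : (ℕ × (Fin 4 → ZMod (2 * L + 1)) × Fin 4 × Fin 4) → Polymer := fun v =>
    if h : (fS.filter fun γ => pc γ = v).Nonempty then
      Classical.choose (Finset.exists_min_image (fS.filter fun γ => pc γ = v) w h)
    else ⟨0, 0, 0, 1, by decide⟩ with hρ
  have hρspec : ∀ v ∈ V, ρ v ∈ fS ∧ pc (ρ v) = v ∧ ∀ γ ∈ fS, pc γ = v → w (ρ v) ≤ w γ := by
    intro v hv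
    have h := hfib v hv
    have hs := Classical.choose_spec (Finset.exists_min_image (fS.filter fun γ => pc γ = v) w h)
    have hρv : ρ v = Classical.choose (Finset.exists_min_image (fS.filter fun γ => pc γ = v) w h) := by
      simp only [hρ, dif_pos h]
    rw [hρv]
    refine ⟨(Finset.mem_filter.1 hs.1).1, (Finset.mem_filter.1 hs.1).2, fun γ hγ hγv => hs.2 γ ?_⟩
    exact Finset.mem_filter.2 ⟨hγ, hγv⟩
  have hρinj : Set.InjOn ρ ↑V := by
    intro v₁ hv₁ v₂ hv₂ h
    rw [← (hρspec v₁ hv₁).2.1, ← (hρspec v₂ hv₂).2.1, h]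
  -- the folded system
  set S : Finset Polymer := V.image ρ with hS
  set c : Fin n → Polymer → ℝ := fun i s => ∑ γ ∈ fS.filter (fun γ => pc γ = pc s), familyCoeff 𝔟 kmax R x i γ with hc
  have hSsub : S ⊆ fS := by
    intro s hs
    obtain ⟨v, hv, rfl⟩ := Finset.mem_image.1 hs
    exact (hρspec v hv).1
  have hSinj : Set.InjOn pc ↑S := by
    intro s₁ hs₁ s₂ hs₂ h
    obtain ⟨v₁, hv₁, rfl⟩ := Finset.mem_image.1 (Finset.mem_coe.1 hs₁)
    obtain ⟨v₂, hv₂, rfl⟩ := Finset.mem_image.1 (Finset.mem_coe.1 hs₂)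
    rw [(hρspec v₁ hv₁).2.1, (hρspec v₂ hv₂).2.1] at h
    rw [h]
  refine ⟨Polymer, S, fun γ => largeFieldEvent (N := N) 𝔟 (ε γ.k) γ, w, c,
    fun γ => measurableSet_largeFieldEvent (N := N) 𝔟 _ γ, fun γ hγ => hw0 γ (hSsub hγ),
    fun i s _ => Finset.sum_nonneg fun γ _ => familyCoeff_nonneg 𝔟 kmax R x i γ, ?_, ?_, ?_, ?_⟩
  · -- domination (i): an identity after folding the family sum along the period classes
    intro i U
    have hdom := influence_eq_familySum (N := N) 𝔟 ε kmax R x i (torusLift (2 * L + 1) U)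
    rw [hdom]
    have hmaps : ∀ γ ∈ fS, pc γ ∈ V := fun γ hγ => Finset.mem_image_of_mem pc hγ
    rw [← Finset.sum_fiberwise_of_maps_to hmaps, hS, Finset.sum_image hρinj]
    refine (Finset.sum_le_sum fun v hv => ?_)
    have hρv := (hρspec v hv).2.1
    -- within the fibre of `v` every indicator is that of the representative
    have hfibre : ∑ γ ∈ fS.filter (fun γ => pc γ = v), familyCoeff 𝔟 kmax R x i γ *
        (largeFieldEvent (N := N) 𝔟 (ε γ.k) γ).indicator (fun _ => (1 : ℝ)) (torusLift (2 * L + 1) U) =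
        (∑ γ ∈ fS.filter (fun γ => pc γ = v), familyCoeff 𝔟 kmax R x i γ) *
          (largeFieldEvent (N := N) 𝔟 (ε (ρ v).k) (ρ v)).indicator (fun _ => (1 : ℝ)) (torusLift (2 * L + 1) U) := by
      rw [Finset.sum_mul]
      refine Finset.sum_congr rfl fun γ hγ => ?_
      rw [indicator_largeFieldEvent_torusLift_eq_of_periodClass_eq (N := N) 𝔟 ε L
        (((Finset.mem_filter.1 hγ).2).trans hρv.symm) U]
    rw [hfibre]
    refine le_of_eq ?_
    simp only [hc, hρv]
  · -- clause (ii) with Λ = 1: the cyclic pigeonhole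
    intro s hs
    simp only [hc]
    exact sum_sum_fiber_familyCoeff_le_one 𝔟 kmax R hRL x hsep fS (pc s)
  · -- the density budget transfers along the `w`-minimising representatives
    intro i
    rw [hS, Finset.sum_image hρinj]
    have hmaps : ∀ γ ∈ fS, pc γ ∈ V := fun γ hγ => Finset.mem_image_of_mem pc hγ
    have hstep : ∀ v ∈ V, c i (ρ v) * w (ρ v) ≤
        ∑ γ ∈ fS.filter (fun γ => pc γ = v), familyCoeff 𝔟 kmax R x i γ * w γ := by
      intro v hv
      have hρv := (hρspec v hv).2.1
      simp only [hc, hρv]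
      rw [Finset.sum_mul]
      refine Finset.sum_le_sum fun γ hγ => ?_
      exact mul_le_mul_of_nonneg_left ((hρspec v hv).2.2 γ (Finset.mem_filter.1 hγ).1 (Finset.mem_filter.1 hγ).2)
        (familyCoeff_nonneg 𝔟 kmax R x i γ)
    refine (Finset.sum_le_sum hstep).trans ?_
    rw [Finset.sum_fiberwise_of_maps_to hmaps]
    exact hwW i
  · -- the product law on the folded (period-free) system
    intro A hA
    exact hpl A (hA.trans hSsub) (hSinj.mono (Finset.coe_subset.2 hA))

end Fold

end Summit.QuantumFields.YangMills.Cruxes.UVSeamRec.TemperedResponse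

end
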